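/-
Copyright (c) 2026 the pub-hodgecm-mathlib formalisation cell (harness21).  Prover seat hodgecm-mathlib-F0P2-p11 (g2) (L1; LEAD F0P6-plan (g14) «(o1) KIND 1», memo
`CENSUS-K1-DealTable` brick (T4-β), the HAAR LETTER of the line chart), Track B «K2-LIT» ∕ hLiu418 #184♮, ROAD Φ, G5-b: THE LINE CHART IS A TOPOLOGICAL ISOMORPHISM
`𝔸_{L⁺} ≅ N_Δ⁽ᴮ⁾(𝔸)` AND CARRIES ADDITIVE HAAR MEASURE TO HAAR MEASURE.  THEOREMS ONLY.
-/
import Summits.HodgeConjecture.HodgeConjecture.Theorems.K2LiuLineCornerChart     -- ★ p862662 (the line chart) (+ ★ `K2LiuUnipDeltaCornerCoordinates`: `im`, ★ p862584)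
import HarnessLib

/-!
# Crux `HLiu418`, KIND 1, brick (T4-β): the line chart `nB` inverts by the imaginary-part coordinate, and `nB_* μ` is a Haar measure of `N_Δ⁽ᴮ⁾(𝔸)`

Cell `hodgecm-mathlib`, crux item hLiu418 = `stmt-HodgeConjecture-24832` (helper lane, count-neutral); squad K2 ∕ K2Liu, LEAD F0P6-plan (g14); prover F0P2-p11 (g2).
THEOREMS ONLY (no `def`, no `instance`, no notation, no named-fact hypothesis, no `sorry`).

For the doubled LINE datum `(eB : Fin 1 × Fin 1 ≃ Fin n₂, dB, dW)` (`dB 0, dW 0 ≠ 0`) and ANY line chart `nB` of ★ p862662's shape (additive, coordinate `X(nB t) = ((t⊗1)δ)·𝟙`):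
* §1 `conjAdele_coord_eq_neg` — the corner coordinate `x(u) = X(u) b b` of `u ∈ N_Δ⁽ᴮ⁾(𝔸)` is anti-invariant, `σ x = −x` (★ `skew_of_mem_unipDelta` on the singleton index, the Gram
  entry being a unit ★ `isUnit_det_gram`); `toBlocks₁₂_eq_of_apply` — `X(u) = x(u)·𝟙`.
* §2 **`lineChart_im_coord`** — `nB (im x(u)) = u` (★ `baseChange_im_mul_delta`, uniqueness ★ p862584); **`im_coord_lineChart`** — `im x(nB t) = t` (★ `im_baseChange_mul_delta`):
  the chart is a bijection with the CONTINUOUS inverse `u ↦ im x(u)` (★ `continuous_im`, ★ `continuous_toBlocks₁₂_blk`); `lineChart_surjective`.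
* §3 **`isHaarMeasure_map_lineChart`** — for an additive Haar measure `μ` on `𝔸_{L⁺}` and a continuous such `nB`, `Measure.map nB μ` IS a Haar measure on `N_Δ⁽ᴮ⁾(𝔸)`:
  left-invariant (additivity + surjectivity + `map_add_left_eq_self`), finite on compacts (through the continuous inverse), positive on opens (continuity + surjectivity).
⇒ ★ p862629 + ★ p862662 + this file: ★ p861327's corner-line integral is `whittakerDelta` of the doubled line at a HAAR carrier `nB_* μ` with NO by-value letter left; by
★ p862409 `smul_whittakerDelta_carrier_eq` any other Haar carrier differs by the covering-weight normalisation only.  (T4) «corner line = carrier A» is ★ END TO END.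
HONEST LABEL.  Count-neutral helper; `HC_CM` is proved only modulo the 7 printed citations (2 remaining named inputs: hLiu418 = `stmt-HodgeConjecture-24832`,
h413 = `stmt-HodgeConjecture-24833`) until rung 0 closes.

## References
* [MoeglinWaldspurger1995] C. Mœglin, J.-L. Waldspurger, CUP (1995), I.2.1, II.1.7 (Haar measures on unipotent radicals).
* [KudlaRallis1994] S. Kudla, S. Rallis, Ann. of Math. 140 (1994), §2.
* [CasselsFrohlichANT1967] J. W. S. Cassels, A. Fröhlich (eds.), *Algebraic Number Theory* (1967), Ch. II §10 (adeles of a quadratic extension).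
-/

set_option autoImplicit false
set_option linter.dupNamespace false -- the mandated namespace repeats `HodgeConjecture.HodgeConjecture`

noncomputable section

open scoped Matrix ENNReal
open NumberField IsDedekindDomain MeasureTheory
open Literature.NumberTheory.Automorphic Literature.NumberTheory.Automorphic.UnitaryGroup Literature.NumberTheory.GaloisRepresentations
open Literature.NumberTheory.GelbartRogawski1991 Literature.NumberTheory.GelbartRogawski1991.GRConstruction
open Literature.NumberTheory.K2Lit.SiegelDoubled
open UnitaryDualPair

namespace Summit.HodgeConjecture.HodgeConjecture.Cruxes.HLiu418.K2LiuLineCornerChartHaar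

open K2LiuSiegelUnipotentFourierDefs K2LiuSiegelUnipotentCharacters K2LiuBlockDiagUnipotentChart K2LiuCornerLineChartTwo K2LiuUnipotentChart
  K2LiuUnipDeltaCornerCoordinates K2LiuLineCornerChart

variable (L : Type) [Field L] [NumberField L] [IsCMField L]
variable {n₂ : ℕ} (eB : Fin 1 × Fin 1 ≃ Fin n₂) (dB : Fin 1 → L) (hdB : ∀ i, IsCMField.complexConj L (dB i) = dB i)
  (dW : Fin 1 → L) (hdW : ∀ i, IsCMField.complexConj L (dW i) = dW i)

/-! ## §1 The corner coordinate of the line is anti-invariant -/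

/-- **`σ x(u) = −x(u)`** for the corner coordinate `x(u) = X(u) b b` of `u ∈ N_Δ⁽ᴮ⁾(𝔸)` (`b = eB (0,0)`): the `(b,b)` entry of the skewness `T X + σ(X)ᵀ T = 0` ★ `skew_of_mem_unipDelta`,
the Gram entry `T b b = det T` being a unit (★ `isUnit_det_gram`, ★ `isUnit_det_realDiagonal`). [cite: MoeglinWaldspurger1995, I.2.1] [cite: CasselsFrohlichANT1967, Ch. II §10] -/
theorem conjAdele_coord_eq_neg (hdB0 : ∀ i, dB i ≠ 0) (hdW0 : ∀ i, dW i ≠ 0) {u : HA L eB dB hdB dW hdW} (hu : u ∈ unipDelta L eB dB hdB dW hdW) :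
    conjAdele (Fp L) L (IsCMField.complexConj L) ((blk L eB dB hdB dW hdW u).toBlocks₁₂ (eB (0, 0)) (eB (0, 0))) =
      -((blk L eB dB hdB dW hdW u).toBlocks₁₂ (eB (0, 0)) (eB (0, 0))) := by
  letI : Unique (Fin n₂) := ⟨⟨eB (0, 0)⟩, fun m => eq_eB eB m⟩
  have hdef : (default : Fin n₂) = eB (0, 0) := rfl
  have hdet : IsUnit (gramR L eB dB hdB dW hdW).det := by
    unfold gramR
    exact isUnit_det_gram (Fp L) eB (isUnit_det_realDiagonal L dB hdB hdB0) (isUnit_det_realDiagonal L dW hdW hdW0)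
  have hTu : IsUnit (((algebraMap L (AdeleRing (𝓞 L) L)).comp (algebraMap (Fp L) L)) (gramR L eB dB hdB dW hdW (eB (0, 0)) (eB (0, 0)))) := by
    have h1 : IsUnit ((gramR L eB dB hdB dW hdW).map ((algebraMap L (AdeleRing (𝓞 L) L)).comp (algebraMap (Fp L) L))).det := by
      rw [← RingHom.mapMatrix_apply, ← RingHom.map_det]
      exact hdet.map _
    rw [Matrix.det_unique, Matrix.map_apply, hdef] at h1
    exact h1
  have hskew := skew_of_mem_unipDelta L eB dB hdB dW hdW hu
  have hbb := congrFun (congrFun hskew (eB (0, 0))) (eB (0, 0))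
  simp only [Matrix.add_apply, Matrix.mul_apply, Fintype.sum_unique, Matrix.transpose_apply, Matrix.map_apply, Matrix.zero_apply, hdef] at hbb
  have h2 : ((algebraMap L (AdeleRing (𝓞 L) L)).comp (algebraMap (Fp L) L)) (gramR L eB dB hdB dW hdW (eB (0, 0)) (eB (0, 0))) *
      (conjAdele (Fp L) L (IsCMField.complexConj L) ((blk L eB dB hdB dW hdW u).toBlocks₁₂ (eB (0, 0)) (eB (0, 0))) +
        (blk L eB dB hdB dW hdW u).toBlocks₁₂ (eB (0, 0)) (eB (0, 0))) = 0 := by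
    rw [mul_add, mul_comm _ (conjAdele (Fp L) L (IsCMField.complexConj L) _), add_comm]
    exact hbb
  exact eq_neg_of_add_eq_zero_left ((hTu.mul_right_eq_zero).1 h2)

/-- on the singleton index the corner coordinate matrix is `x(u)·𝟙`. [folklore] -/
theorem toBlocks₁₂_eq_of_apply (u : HA L eB dB hdB dW hdW) :
    (blk L eB dB hdB dW hdW u).toBlocks₁₂ = Matrix.of fun _ _ => (blk L eB dB hdB dW hdW u).toBlocks₁₂ (eB (0, 0)) (eB (0, 0)) := by
  ext i j
  rw [eq_eB eB i, eq_eB eB j, Matrix.of_apply]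

/-! ## §2 The chart inverts by the imaginary part of the corner coordinate -/

/-- **`nB (im x(u)) = u`** for `u ∈ N_Δ⁽ᴮ⁾(𝔸)` (★ `baseChange_im_mul_delta` on the anti-invariant coordinate §1, uniqueness ★ p862584). [cite: MoeglinWaldspurger1995, I.2.1] -/
theorem lineChart_im_coord (hdB0 : ∀ i, dB i ≠ 0) (hdW0 : ∀ i, dW i ≠ 0)
    (nB : AdeleRing (𝓞 (Fp L)) (Fp L) → unipDelta L eB dB hdB dW hdW)
    (hnB : ∀ t, (blk L eB dB hdB dW hdW (nB t : HA L eB dB hdB dW hdW)).toBlocks₁₂ =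
      Matrix.of fun _ _ => AdeleRing.baseChange (Fp L) L t * algebraMap L (AdeleRing (𝓞 L) L) (imagUnit L))
    (u : unipDelta L eB dB hdB dW hdW) :
    nB ((quadraticAdeleEquiv (Fp L) L (IsCMField.complexConj L) (complexConj_imagUnit L) (imagUnit_ne_zero L)).symm
      ((blk L eB dB hdB dW hdW (u : HA L eB dB hdB dW hdW)).toBlocks₁₂ (eB (0, 0)) (eB (0, 0)))).2 = u := by
  apply Subtype.ext
  refine eq_of_mem_unipDelta_of_toBlocks₁₂_eq L eB dB hdB dW hdW (nB _).2 u.2 ?_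
  rw [hnB, baseChange_im_mul_delta L (conjAdele_coord_eq_neg L eB dB hdB dW hdW hdB0 hdW0 u.2), ← toBlocks₁₂_eq_of_apply]

/-- **`im x(nB t) = t`** (★ `im_baseChange_mul_delta`). [cite: CasselsFrohlichANT1967, Ch. II §10] -/
theorem im_coord_lineChart (nB : AdeleRing (𝓞 (Fp L)) (Fp L) → unipDelta L eB dB hdB dW hdW)
    (hnB : ∀ t, (blk L eB dB hdB dW hdW (nB t : HA L eB dB hdB dW hdW)).toBlocks₁₂ =
      Matrix.of fun _ _ => AdeleRing.baseChange (Fp L) L t * algebraMap L (AdeleRing (𝓞 L) L) (imagUnit L)) (t : AdeleRing (𝓞 (Fp L)) (Fp L)) :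
    ((quadraticAdeleEquiv (Fp L) L (IsCMField.complexConj L) (complexConj_imagUnit L) (imagUnit_ne_zero L)).symm
      ((blk L eB dB hdB dW hdW (nB t : HA L eB dB hdB dW hdW)).toBlocks₁₂ (eB (0, 0)) (eB (0, 0)))).2 = t := by
  rw [hnB, Matrix.of_apply]
  exact im_baseChange_mul_delta L t

/-- the line chart is surjective onto `N_Δ⁽ᴮ⁾(𝔸)`. [cite: MoeglinWaldspurger1995, I.2.1] -/
theorem lineChart_surjective (hdB0 : ∀ i, dB i ≠ 0) (hdW0 : ∀ i, dW i ≠ 0)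
    (nB : AdeleRing (𝓞 (Fp L)) (Fp L) → unipDelta L eB dB hdB dW hdW)
    (hnB : ∀ t, (blk L eB dB hdB dW hdW (nB t : HA L eB dB hdB dW hdW)).toBlocks₁₂ =
      Matrix.of fun _ _ => AdeleRing.baseChange (Fp L) L t * algebraMap L (AdeleRing (𝓞 L) L) (imagUnit L)) :
    Function.Surjective nB :=
  fun u => ⟨_, lineChart_im_coord L eB dB hdB dW hdW hdB0 hdW0 nB hnB u⟩

/-- the inverse coordinate `u ↦ im x(u)` is continuous (★ `continuous_im`, ★ `continuous_toBlocks₁₂_blk`). [cite: MoeglinWaldspurger1995, I.2.1] -/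
theorem continuous_im_coord :
    Continuous fun u : unipDelta L eB dB hdB dW hdW =>
      ((quadraticAdeleEquiv (Fp L) L (IsCMField.complexConj L) (complexConj_imagUnit L) (imagUnit_ne_zero L)).symm
        ((blk L eB dB hdB dW hdW (u : HA L eB dB hdB dW hdW)).toBlocks₁₂ (eB (0, 0)) (eB (0, 0)))).2 :=
  (continuous_im L).comp (((continuous_toBlocks₁₂_blk L eB dB hdB dW hdW).comp continuous_subtype_val).matrix_elem (eB (0, 0)) (eB (0, 0)))

/-! ## §3 The push-forward of additive Haar measure is Haar measure -/

/-- **`nB_* μ` IS A HAAR MEASURE ON `N_Δ⁽ᴮ⁾(𝔸)`** for an additive Haar measure `μ` on `𝔸_{L⁺}` and a continuous additive line chart `nB` with the prescribed coordinate (★ p862662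
`exists_lineChart`): left-invariance from additivity and surjectivity (`map_add_left_eq_self`), finiteness on compacts through the continuous inverse `u ↦ im x(u)` (§2),
positivity on opens from continuity and surjectivity. [cite: MoeglinWaldspurger1995, I.2.1, II.1.7] [cite: KudlaRallis1994, §2] -/
theorem isHaarMeasure_map_lineChart (hdB0 : ∀ i, dB i ≠ 0) (hdW0 : ∀ i, dW i ≠ 0)
    [MeasurableSpace (AdeleRing (𝓞 (Fp L)) (Fp L))] [BorelSpace (AdeleRing (𝓞 (Fp L)) (Fp L))]
    [MeasurableSpace (unipDelta L eB dB hdB dW hdW)] [BorelSpace (unipDelta L eB dB hdB dW hdW)]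
    (μ : Measure (AdeleRing (𝓞 (Fp L)) (Fp L))) [μ.IsAddHaarMeasure]
    (nB : AdeleRing (𝓞 (Fp L)) (Fp L) → unipDelta L eB dB hdB dW hdW) (hnBc : Continuous nB) (hnBadd : ∀ s t, nB (s + t) = nB s * nB t)
    (hnB : ∀ t, (blk L eB dB hdB dW hdW (nB t : HA L eB dB hdB dW hdW)).toBlocks₁₂ =
      Matrix.of fun _ _ => AdeleRing.baseChange (Fp L) L t * algebraMap L (AdeleRing (𝓞 L) L) (imagUnit L)) :
    (Measure.map nB μ).IsHaarMeasure := by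
  haveI : T2Space (InfiniteAdeleRing L) := inferInstanceAs (T2Space ((v : InfinitePlace L) → v.Completion))
  haveI : T2Space (FiniteAdeleRing (𝓞 L) L) :=
    inferInstanceAs (T2Space (RestrictedProduct (fun v : HeightOneSpectrum (𝓞 L) => v.adicCompletion L)
      (fun v => (v.adicCompletionIntegers L : Set (v.adicCompletion L))) Filter.cofinite))
  haveI : T2Space (AdeleRing (𝓞 L) L) := inferInstanceAs (T2Space (InfiniteAdeleRing L × FiniteAdeleRing (𝓞 L) L))
  haveI : T2Space (unipDelta L eB dB hdB dW hdW) := inferInstance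
  have hnBm : Measurable nB := hnBc.measurable
  have hsurj := lineChart_surjective L eB dB hdB dW hdW hdB0 hdW0 nB hnB
  have hinv := lineChart_im_coord L eB dB hdB dW hdW hdB0 hdW0 nB hnB
  have hinv' := im_coord_lineChart L eB dB hdB dW hdW nB hnB
  have hcc := continuous_im_coord L eB dB hdB dW hdW
  have h_inv : ∀ u₀ : unipDelta L eB dB hdB dW hdW, Measure.map (fun u => u₀ * u) (Measure.map nB μ) = Measure.map nB μ := by
    intro u₀
    obtain ⟨t₀, rfl⟩ := hsurj u₀
    have hmul : Measurable fun u : unipDelta L eB dB hdB dW hdW => nB t₀ * u :=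
      Continuous.measurable (by exact continuous_const.mul continuous_id)
    rw [Measure.map_map hmul hnBm,
      show (fun u => nB t₀ * u) ∘ nB = nB ∘ fun t => t₀ + t from funext fun t => (hnBadd t₀ t).symm,
      ← Measure.map_map hnBm (measurable_const_add t₀), map_add_left_eq_self]
  have h_cpt : ∀ K : Set (unipDelta L eB dB hdB dW hdW), IsCompact K → Measure.map nB μ K < ∞ := by
    intro K hK
    rw [Measure.map_apply hnBm hK.measurableSet]
    refine lt_of_le_of_lt (measure_mono fun t ht => ?_) ((hK.image hcc).measure_lt_top (μ := μ))
    exact ⟨nB t, ht, hinv' t⟩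
  have h_open : ∀ U : Set (unipDelta L eB dB hdB dW hdW), IsOpen U → U.Nonempty → Measure.map nB μ U ≠ 0 := by
    intro U hU hne
    rw [Measure.map_apply hnBm hU.measurableSet]
    obtain ⟨u, hu⟩ := hne
    exact (hU.preimage hnBc).measure_ne_zero μ ⟨_, show nB _ ∈ U by rw [hinv u]; exact hu⟩
  exact { map_mul_left_eq_self := h_inv, lt_top_of_isCompact := h_cpt, open_pos := h_open }

end Summit.HodgeConjecture.HodgeConjecture.Cruxes.HLiu418.K2LiuLineCornerChartHaar

end
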